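import Summits.Ventures.CertifiedManyBodySolver.Certificates.HubRm2uTierP.Head
import Summits.Ventures.CertifiedManyBodySolver.Certificates.HubRm2uTierP.Hints002
import Summits.Ventures.CertifiedManyBodySolver.Certificates.HubRm2uTierP.Hints003
import Summits.Ventures.CertifiedManyBodySolver.Rows.CorrWindowCertKernelChainQuotAdjFastBox

/-!
# tier-P instance (HubRm2u-R13-W3) — chain forest segment 7 of 96 (steps 28..31 from `[]`), file 1 of 1: steps 28..31 (topology (B): eval%-chained accumulators, import-serial INSIDE the segment only)

Generated by hubbard-algo-p2's untrusted exporter (emit_v0.py + emit_w3.py); every datum below is re-derived / re-checked by the kernel chain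
(`stepEQA`, Rows/CorrWindowCertKernelChainQuotAdj.lean) or is inert. HONEST FRAMING (xx1): instance data / kernel replay of a CONTROL/CALIBRATION
certificate (hub-Rm2-u′, 4^40-dyadic two-level Gram factors); nothing here is a theorem about the Hubbard model; no summit statement. [cite: Han2020Bootstrap, §3]
-/

set_option linter.style.longLine false
set_option maxRecDepth 100000
set_option maxHeartbeats 0

namespace Summit.Ventures.CertifiedManyBodySolver
namespace CARPolyWindow.TierP.HubRm2u
open Summit.Ventures.CertifiedQuantumChemistry Summit.Ventures.CertifiedQuantumChemistry.CARPoly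
open Literature.MathematicalPhysics.QuantumLattice Literature.MathematicalPhysics.QuantumLattice.HubbardWave0
open Literature.Probability.LatticeModels
open CARPolyWindow CARPolyWindow.BoxGeom

/-- segment 7 starts from the EMPTY accumulator before step 28 (chain forest, R-g4-11 (L6)). [folklore] -/
def C7_0 : SOSDual.EncPoly := []

/-- accumulator after step 29 within segment 7 (evaluated at elaboration; the kernel re-derives it in `step_28`). [folklore] -/
def C7_1 : SOSDual.EncPoly := eval% stepEQA D 2048 C7_0 (slices.getD 28 []) (hintsOfCodes Dr reps HC28)

/-- KERNEL FACT, step 28 of 350 (fast step (L7): `stepEQAFB_kernel`, box edition). [folklore] -/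
theorem step_28 : C7_1 = stepEQA D 2048 C7_0 (slices.getD 28 []) (hintsOfCodes Dr reps HC28) :=
  stepEQAFB_kernel 6 13 7 rfl (by decide +kernel)

/-- accumulator after step 30 within segment 7 (evaluated at elaboration; the kernel re-derives it in `step_29`). [folklore] -/
def C7_2 : SOSDual.EncPoly := eval% stepEQA D 2048 C7_1 (slices.getD 29 []) (hintsOfCodes Dr reps HC29)

/-- KERNEL FACT, step 29 of 350 (fast step (L7): `stepEQAFB_kernel`, box edition). [folklore] -/
theorem step_29 : C7_2 = stepEQA D 2048 C7_1 (slices.getD 29 []) (hintsOfCodes Dr reps HC29) :=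
  stepEQAFB_kernel 6 13 7 rfl (by decide +kernel)

/-- accumulator after step 31 within segment 7 (evaluated at elaboration; the kernel re-derives it in `step_30`). [folklore] -/
def C7_3 : SOSDual.EncPoly := eval% stepEQA D 2048 C7_2 (slices.getD 30 []) (hintsOfCodes Dr reps HC30)

/-- KERNEL FACT, step 30 of 350 (fast step (L7): `stepEQAFB_kernel`, box edition). [folklore] -/
theorem step_30 : C7_3 = stepEQA D 2048 C7_2 (slices.getD 30 []) (hintsOfCodes Dr reps HC30) :=
  stepEQAFB_kernel 6 13 7 rfl (by decide +kernel)

/-- accumulator after step 32 within segment 7 (evaluated at elaboration; the kernel re-derives it in `step_31`). [folklore] -/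
def C7_4 : SOSDual.EncPoly := eval% stepEQA D 2048 C7_3 (slices.getD 31 []) (hintsOfCodes Dr reps HC31)

/-- KERNEL FACT, step 31 of 350 (fast step (L7): `stepEQAFB_kernel`, box edition). [folklore] -/
theorem step_31 : C7_4 = stepEQA D 2048 C7_3 (slices.getD 31 []) (hintsOfCodes Dr reps HC31) :=
  stepEQAFB_kernel 6 13 7 rfl (by decide +kernel)


end CARPolyWindow.TierP.HubRm2u
end Summit.Ventures.CertifiedManyBodySolver
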